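import Summits.BirchSwinnertonDyer.Rank1Residual.X11b.RegMultCertificateJoin
import Summits.BirchSwinnertonDyer.BirchSwinnertonDyer.Theses.ClassRecordThree
import HarnessLib

/-!
# Route `ClassRecordThree` (rung K2@3, D-0059), crux `SchneiderAtThree` (item 19106): the crux AT ONE CURVE
# from ONE certificate row, and the class-wide crux from per-curve certificates — the kernel reading of the
# REG3CERT/v1 table (cell `bsd-stepL`, seat `bsd-stepL-reg3-eng`; `--supports stmt-BirchSwinnertonDyer-19106`)

HONEST FRAMING: BSD is not proved by any of this; nothing here closes the crux or the rung leaf; the class-wide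
statement behind a regulator certificate is Schneider's non-degeneracy conjecture (barrier
`Literature.Barriers.BirchSwinnertonDyer.PAdicHeightNondegeneracy`), asserted NOWHERE below. A certificate row is
EVIDENCE (instrument tier): a per-pair COMPUTED input, entering as the hypothesis `RegMult.CertNonsplit W 3 P m`
(`X11b/RegMultCertificateJoin.lean` §3: `m • P` admissible and the Stein–Wuthrich §4.2 height
`heightFourOne W 3 q (m • P) ≠ 0` for THE Tate parameter `q`), never as a fact.

What this file records (theorems only; 0 definitions, 0 named facts):

* `schneiderAtThree_at_of_certNonsplit` — the MATRIX of the crux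
  `SchneiderAtThree := ∀ W, ClassX11b W 3 → Ram W 3 → ¬ split(3) → ClassClosure.RegulatorNonvanishingAt W 3`
  at ONE curve `W`, from GZK (`hGZK`, rank one on `ClassX11b`: `analyticRank = 1` is the first conjunct of
  `ClassX11b`) and ONE non-split certificate `RegMult.CertNonsplit W 3 P m` (any point `P`, any multiplier `m`):
  `RegMult.regulatorNonvanishingAt_of_cert_of_not_split` (the split half of the bundled predicate is vacuous at a
  non-split prime). This is the exact shape in which the BC5 rung `stub_rung_62310y1` of the crux's skeleton
  (`Cruxes/SchneiderAtThree/Lines/birth.lean`) is served by a table row: for `W = ⟨1,1,1,30,-63⟩` (62310y1,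
  non-split at `3`, `(ram)` via `ℓ = 5`) the row `62310y1@3` of REG3CERT/v1 (table of record kit j249075, evidence on item 19106; cell file
  `run/shared/lean/pub/bsd-stepL/reg3/REG3CERT-TABLE.md`) certifies `CertNonsplit W 3 P 2` with `P = (91/36, 959/216)`:
  `2 • P = (809689/240², −909043067/240³)` is admissible and `heightFourOneCoord W 3 q _ _ = 3 + 2·3² + 3³ + 2·3⁴ +
  3⁵ + 3⁸ + ⋯ + O(3⁵⁰)` (valuation `1 < 50`), i.e. `ĥ₃(P) = 3 + 3² + 2·3⁴ + 2·3⁵ + 2·3⁷ + ⋯` — agreeing with PARI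
  2.17.2 `ellpadicregulator` to all its 24/30 digits and with REG-MULT's second engine to all its 37; the
  table certifies such a row for 723/723 TRUE-OPEN non-split (ram) X11b classes at `3` below `5·10⁵` and for the
  six REG-MULT residue pairs (REG-MULT becomes 5 546/5 546, zero rows 0) — EVIDENCE, per pair.
* `schneiderAtThree_of_forall_certNonsplit` — the crux BY NAME from GZK and a certificate FOR EVERY curve of the
  locus (the honest class-wide reading of a certificate table: 723/723 TRUE-OPEN non-split X11b classes at `3`
  below `5·10⁵` have a row; the `∀` is Schneider's conjecture on this locus and is NOT supplied by any finite table).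

References: [SteinWuthrich2013] §4.2 (p. 15), Conj. 4.1; [Schneider1982PadicHeightI] §1;
[KolyvaginEulerSystems1990] Thm. A (GZK); cell files `X11b/RegMultCertificateJoin.lean` (p-ids in its header),
`X11b/ClassClosureTyped.lean` (`RegulatorNonvanishingAt`).
-/

open scoped Classical

open WeierstrassCurve Literature.NumberTheory.EllipticCurves
  Literature.NumberTheory.EllipticCurves.Rank1Residual
  Summit.BirchSwinnertonDyer.Rank1Residual
  Summit.BirchSwinnertonDyer.Rank1Residual.X11b

namespace Summit.BirchSwinnertonDyer.Rank1Residual.X11b.RegMult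

/-- **`SchneiderAtThree` at ONE curve from ONE certificate row.** For `W` globally minimal in class X11b at `3`
(so `ord_{s=1} L(E,s) = 1`), GZK gives Mordell–Weil rank one; a non-split REGMULT/REG3CERT row
`RegMult.CertNonsplit W 3 P m` (admissible `m • P` with non-zero Stein–Wuthrich §4.2 height for THE Tate
parameter) then yields the bundled predicate `ClassClosure.RegulatorNonvanishingAt W 3` — Schneider's conjecture
for THE canonical `3`-adic height datum of this pair (`RegMult.regulatorNonvanishingAt_of_cert_of_not_split`; the
split clause is vacuous since `TateParameterData W 3` is empty at a non-split prime). The `Ram W 3` binder of the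
crux is not used. Per pair; EVIDENCE-fed; nothing class-wide is asserted.
[cite: SteinWuthrich2013, §4.2 (p. 15) and Conj. 4.1] [cite: KolyvaginEulerSystems1990, Thm. A] -/
theorem schneiderAtThree_at_of_certNonsplit (hGZK : rank_eq_analyticRank_of_analyticRank_le_one)
    (W : WeierstrassCurve ℚ) [W.IsElliptic] [W.IsGloballyMinimal] {P : W.toAffine.Point} {m : ℕ}
    (hc : RegMult.CertNonsplit W 3 P m) :
    ClassX11b W 3 → Ram W 3 → ¬ W.HasSplitMultiplicativeReductionAtPrime 3 →
      ClassClosure.RegulatorNonvanishingAt W 3 :=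
  fun hX _ hns =>
    RegMult.regulatorNonvanishingAt_of_cert_of_not_split (mordellWeilRank_eq_one_of_analyticRank hGZK hX.1) hns hc

/-- **The crux `SchneiderAtThree` BY NAME from GZK and a non-split certificate for EVERY curve of its locus.**
If every globally minimal `W` in class X11b at `3` with a (ram) prime and non-split reduction at `3` admits SOME
point `P` and multiplier `m` with `RegMult.CertNonsplit W 3 P m`, then `SchneiderAtThree`. The hypothesis
quantifies over the whole (infinite) locus — it IS Schneider's non-degeneracy on that locus in certificate
currency; a finite table (REG-MULT 723/723, REG3CERT/v1 723/723 below `5·10⁵`) instantiates it row by row and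
never discharges the `∀`. Recorded so that the route's deciding crux has its certificate-shaped reduction in the
tree next to the per-curve theorem. [cite: SteinWuthrich2013, §4.2 and Conj. 4.1]
[cite: Schneider1982PadicHeightI, §1] -/
theorem schneiderAtThree_of_forall_certNonsplit (hGZK : rank_eq_analyticRank_of_analyticRank_le_one)
    (hc : ∀ (W : WeierstrassCurve ℚ) [W.IsElliptic] [W.IsGloballyMinimal],
      ClassX11b W 3 → Ram W 3 → ¬ W.HasSplitMultiplicativeReductionAtPrime 3 →
        ∃ (P : W.toAffine.Point) (m : ℕ), RegMult.CertNonsplit W 3 P m) :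
    Summit.BirchSwinnertonDyer.BirchSwinnertonDyer.Theses.ClassRecordThree.SchneiderAtThree := by
  intro W _ _ hX hram hns
  obtain ⟨P, m, hPm⟩ := hc W hX hram hns
  exact schneiderAtThree_at_of_certNonsplit hGZK W hPm hX hram hns

end Summit.BirchSwinnertonDyer.Rank1Residual.X11b.RegMult
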